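import Literature.MathematicalPhysics.QuantumFieldTheory.Balaban1983to89.B9Eq365QGGQLowerVariationalWindowTower
import Literature.MathematicalPhysics.QuantumFieldTheory.Balaban1983to89.B9Eq365QGGQLowerVariationalWindowUniform

/-!
# `Balaban1983to89.B9Eq365QGGQLowerVariationalWindowTowerDiagonal` — T. Bałaban, *Propagators for lattice gauge theories in a background field*,
# Commun. Math. Phys. **99** (1985) 389–434 [Balaban1985BackgroundPropagators] Thm 3.11 p. 416 with (3.16)∕(3.19) p. 393, (3.24)–(3.25) p. 394,
# (3.35)–(3.37) p. 396, and [Balaban1984PropagatorsI] (1.18) p. 20: **ON PRINT's DIAGONAL `ηL^{n+1} = 1`, `c₀(L^{n+1})^d = c₁`, UNDER THE GEOMETRIC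
# SMALL-FIELD PROFILE `ε_j ≤ αr^j`, THE `k`-LEVEL THIRD OPERATOR `Q̃′_kG′_k(U)²Q̃′_k(U)†` IS BOUNDED BELOW BY ONE NUMBER `κ₀(d, a′, 2M_φM_φ′)` — NO HEIGHT
# `n`, NO BLOCK RATIO `L`, NO RATE `r`, NO `η`, NO PERIOD `m`, NO WEIGHTS — AND `∃ κ > 0` STANDS BEFORE `∀ L, r`, `∃ α₁ > 0` BEFORE EVERY LATTICE ∕
# HEIGHT ∕ BACKGROUND BINDER**: the pub-balaban NE9 refuter desk's item KAPPA1, `k`-level half, in the `∃`-first shape it asks for (sequel of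
# `B9Eq365QGGQLowerVariationalWindowTower`, same seat)

statement-level skeleton of published theorems with citation tags; proofs where landed; nothing here is a claim about the Yang–Mills mass gap

CITATION HEADER (lean-in-tree rule).  Audit cell `pub-balaban`, sub-cell `t4`, BINDER row NE9; filed by NE9 crux-team LEAF PROVER 03
(`b2b-balaban-t4-ne9-formalise-leaf-03`, gen 73).  LOCUS: refuter desk KEEP∕KILL draft v4 (gen 48) §3∕§5 (c) «no decl displaying the third operator
Q̃′_kG′_k(U)²Q̃′_k(U)†'s covariant lower bound with `∃ κ > 0` before the block ratio ∕ height»; t4-ne9-idea-1 g116 memo §E (E.1)∕(E.2) (the one-shot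
reading «κ_W(L, α) ≥ κ_one-shot(d, a′, K, α) for EVERY block ratio L ≥ 3» by two monotonicity remarks — here the same remarks at block size `L^{n+1}`
for the GENUINE tower operator).  Composed BY NAME from the prequel's closed form `qggq_coercive_window_tower`, this lineage's g64 profile bound
`B9Thm311SitePrimeFormCoerciveTowerCanonical.rhoTower_le_exp_sub_one` and the pure-real floor of `B9Eq365QGGQLowerVariationalWindowUniform` (same seat).  Sources READ: as the prequel ([B9] pp. 393–396, 416; [B5′] p. 20).

THE PRINT (verbatim).  [B9] p. 416 Thm 3.11: *«the operators Δ′_a, G′, (Q′G′²Q′*)⁻¹, Δ_a, G are positive definite … uniformly bounded»*; p. 396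
(3.35)–(3.37): the small-field conditions at every level; [B5′] (1.18) p. 20: *«a composition of k transformations … is again a transformation of the
same type with L replaced by L^k»*.  NOTHING of print's constants or of the random-walk expansion is asserted; the floor below is the cell's crude
variational one (degenerate tent), its SIZE is not print's.

WHAT IS PROVED (sorry-free; proof lane — 0 `def`; [folklore] real arithmetic on the prequel's closed form).
* §2 (the pure-real floor `qggq_constant_scaled_ge` and the ratio `window_of_ratio` are IMPORTED from this seat's
  `B9Eq365QGGQLowerVariationalWindowUniform`, where they also serve the one-shot operator: `β ≥ (N²∕27)^d`, the powers of `N` cancel, `κ₀ = 1∕(36Λ²)`,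
  `Λ = (32d + 2dK²)(729∕16)^d + 9a′∕4`.)
  **`qggq_coercive_tower_diagonal_geometric`** — for `3 ≤ L`, on the diagonal, fine bonds `‖U(b) − 1‖ ≤ αη` in `U1`, level averages
  `‖Ū^j(b) − 1‖ ≤ ε_j ≤ αr^j` in `U1`, `hRS`, `hpos′`, `0 ≤ α ≤ 1` and the LEVEL-FREE window `exp(d(L−1)Kα∕(1−r)) − 1 ≤ (4∕27)^d∕2`:
  `κ₀·‖ψ‖² ≤ re⟪ψ, Q̃′_kG′_k(U)²Q̃′_k(U)†ψ⟫` — the operator of `B9Eq325ProjFormulaTower.QGGQk_pos` VERBATIM, the SAME `κ₀` at every height.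
* §3 **`exists_qggq_coercive_tower_diagonal`** — `∃ κ > 0, ∀ L ≥ 3, ∀ r ∈ [0,1[, ∃ α₁ > 0, ∀ n η c₀ c₁ m U α (ε_j) hpos′ ψ` of the diagonal window:
  `κ‖ψ‖² ≤ re⟪ψ, Q̃′_kG′_k(U)²Q̃′_k(U)†ψ⟫` — `κ` BEFORE the block ratio, the rate and the height; `α₁ = min 1 ((4∕27)^d∕(4(c+1)))`, `c = d(L−1)K∕(1−r)`.
  **`exists_qggq_coercive_tower_diagonal_closed`** — the same with the POSITIVITY LETTER DISCHARGED as well: in the (smaller) window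
  `α ≤ min α₀ α₁` the operator `Δ′_{a′,k}(U)` IS positive definite (this lineage's g64 `exists_strong_site_coercive_tower_diagonal` through the owner's
  `laplacePrimeAk_pos_of_coercive'`) AND the bound holds for every witness — no displayed letter left but print's running axioms.
* §4 JUNCTION AT HEIGHT ZERO: `UlevOf_one_zero` (`Ū⁰ = U`), **`QprimeTowerW_zero`** (`Q′_1(U) = Q′(U)`), `laplacePrimeAk_zero`, `GpOfUk_zero`,
  **`QGGQk_zero`** — at `n = 0` the `k`-level third operator IS ne9-leaf-06's one-shot `B9Eq325ProjFormula.QGGQ_pos` operator LITERALLY (any two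
  positivity witnesses): the two halves of KAPPA1 are ONE family (`towerP L m 1 = fineP L m` by `rfl`).
HONEST SCOPE.  Packaging + threshold arithmetic; the number `κ₀` is tiny (crude tent at the degenerate mass letter) and is NOT print's constant; the
profile, `hRS` and `U, Ū^j ∈ U1` are DISPLAYED (print's running axioms (3.35)–(3.37)); `L²` floor only — NOT the kernel decay of `(Q̃′_kG′_k²Q̃′_k†)⁻¹`,
NOT NE9, NOT the route (cell pub-balaban: NE9 NOT PRINTED ∕ NOT PROVED; «NE9 ⇐ the named binders»; row WALLED ON A MODEL (O-NE9-1; #5 UNRULED); spine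
PROVED 0∕9; rung (B)+1 on a finite T⁴ — NOT infinite volume, NOT mass gap, NOT BetaPertH, NOT Clay; HONEST DEPENDENCY: continuum YM on T⁴ ⇐ BetaPertH ∧
nine spine estimates (0/9 proved); BetaPertH ⇐ (D1) ∧ (D4) ∧ CAP+tail; G-an2-4 gates asym, D1 and NE2/3/4).  NEW file importing the prequel and `…WindowUniform`;
nothing modified.  Net new unproved facts: 0.
-/

noncomputable section

open scoped InnerProductSpace ComplexConjugate BigOperators

namespace Literature.MathematicalPhysics.QuantumFieldTheory.Balaban1983to89.B9Eq365QGGQLowerVariationalWindowTowerDiagonal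

open B4Sect5Torus (TSite)
open B9SectCLatticeCarrier (Bond)
open B7Prop1Explicit (U1)
open B9Eq311L2Pairing (WL2)
open B11Eq103H1Complex (SiteL2K)
open B9Eq310HessianOperator (adTransportW)
open B9Eq315QTower (towerP UlevOf QprimeTower_succ QprimeTower_zero)
open B9Eq315QTorus (perCfg)
open B9Eq315QTorusOnto (perSite_liftSite)
open B9Eq319QprimeTorus (fineP)
open B9Eq326OperatorAssembly (QprimeW)
open B9Eq3119DeltaPiCarrier (laplacePrimeA GpOfU)
open B9Eq326OperatorTower (QprimeTowerW)
open B9Eq324DeltaPrimeATower (laplacePrimeAk GpOfUk laplacePrimeAk_pos_of_coercive')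
open B11Eq103H1Complex (covDerivL2K)
open B9Thm311SitePrimeFormCoerciveTowerCanonical (rhoTower_nonneg rhoTower_le_exp_sub_one exists_strong_site_coercive_tower_diagonal)
open B9Eq365QGGQLowerVariationalWindowTower (qggq_coercive_window_tower)
open B9Eq365QGGQLowerVariationalWindowUniform (qggq_constant_scaled_ge window_of_ratio)

/-! ## §2 Print's diagonal `ηL^{n+1} = 1`, `c₀(L^{n+1})^d = c₁` under the geometric profile: a floor in `(d, a′, K)` only -/

section Diagonal

variable {d : ℕ} (L : ℕ) [NeZero L] (m : Fin d → ℕ) [∀ i, NeZero (m i)] (n : ℕ)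
  {𝔸 : Type*} [NormedRing 𝔸] [NormedAlgebra ℂ 𝔸] [CompleteSpace 𝔸] [NormOneClass 𝔸]
  {W : Type*} [NormedAddCommGroup W] [InnerProductSpace ℂ W] [FiniteDimensional ℂ W] (φ : W ≃ₗ[ℂ] 𝔸)
  (c₀ : ℝ) [Fact (0 < c₀)] (η : ℝ) (c₁ : ℝ) [Fact (0 < c₁)]

/-- **THE `k`-LEVEL THIRD OPERATOR ON PRINT's DIAGONAL UNDER THE GEOMETRIC PROFILE — ONE CONSTANT `κ₀(d, a′, K)` AT EVERY HEIGHT**: for `3 ≤ L`,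
`ηL^{n+1} = 1`, `c₀(L^{n+1})^d = c₁`, fine bonds `‖U(b) − 1‖ ≤ αη` in `U1` ((3.35)), level averages `‖Ū^j(b) − 1‖ ≤ ε_j ≤ αr^j` in `U1` ((3.37)),
mutually adjoint transporters, the displayed positivity `hpos′`, `0 ≤ α ≤ 1` and the LEVEL-FREE window `exp(d(L−1)Kα∕(1−r)) − 1 ≤ (4∕27)^d∕2`
(`K = 2M_φM_φ′`): `κ₀·‖ψ‖² ≤ re⟪ψ, Q̃′_kG′_k(U)²Q̃′_k(U)†ψ⟫`, `κ₀ = 1∕(36Λ²)`, `Λ = (32d + 2dK²)(729∕16)^d + 9a′∕4` — NO `n`, NO `L`, NO `r`, NO `η`,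
NO `m`, NO `c₀, c₁` in the constant (the prequel at `ε := αη` + `rhoTower_le_exp_sub_one` + `window_of_ratio` + `qggq_constant_scaled_ge`).
[cite: Balaban1985BackgroundPropagators, Thm 3.11 p.416, (3.19) p.393, (3.24)–(3.25) p.394, (3.35)–(3.37) p.396; Balaban1984PropagatorsI, (1.18) p.20] -/
theorem qggq_coercive_tower_diagonal_geometric (hL3 : 3 ≤ L) {a' : ℝ} (ha' : 0 < a') {Mφ Mφ' : ℝ} (hMφ : 0 ≤ Mφ) (hMφ' : 0 ≤ Mφ')
    (hφ : ∀ w, ‖φ w‖ ≤ Mφ * ‖w‖) (hφ' : ∀ X, ‖φ.symm X‖ ≤ Mφ' * ‖X‖)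
    (U : Bond d (towerP L m (n + 1)) → 𝔸ˣ) (hU : ∀ b, U b ∈ U1 𝔸) {α : ℝ} (hα0 : 0 ≤ α) (hα1 : α ≤ 1)
    (hUε : ∀ b, ‖(U b : 𝔸) - 1‖ ≤ α * η) (εU : ℕ → ℝ) (hεU : ∀ j, 0 ≤ εU j)
    (hLε : ∀ (j : ℕ) (b : Bond d (towerP L m (j + 1))), ‖(UlevOf L m (n + 1) U j b : 𝔸) - 1‖ ≤ εU j)
    (hLb : ∀ (j : ℕ) (b : Bond d (towerP L m (j + 1))), UlevOf L m (n + 1) U j b ∈ U1 𝔸)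
    (hRS : ∀ (b : Bond d (towerP L m (n + 1))) (v u : W), ⟪adTransportW φ U b v, u⟫_ℂ = ⟪v, adTransportW φ (fun b => (U b)⁻¹) b u⟫_ℂ)
    (hpos' : ∀ x : SiteL2K ℂ d (towerP L m (n + 1)) c₀ W, x ≠ 0 → 0 < RCLike.re ⟪x, laplacePrimeAk L m n φ η U a' (c₁ := c₁) x⟫_ℂ)
    (hηL : η * (L : ℝ) ^ (n + 1) = 1) (hw : c₀ * ((L : ℝ) ^ (n + 1)) ^ d = c₁)
    {r : ℝ} (hr0 : 0 ≤ r) (hr1 : r < 1) (hεg : ∀ j < n + 1, εU j ≤ α * r ^ j)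
    (hwin : Real.exp (((d * (L - 1) : ℕ) : ℝ) * (2 * Mφ * Mφ' * α / (1 - r))) - 1 ≤ (4 / 27 : ℝ) ^ d / 2)
    (ψ : SiteL2K ℂ d m c₁ W) :
    1 / (36 * ((32 * (d : ℝ) + 2 * (d : ℝ) * (2 * Mφ * Mφ') ^ 2) * (729 / 16) ^ d + 9 * a' / 4) ^ 2) * ‖ψ‖ ^ 2 ≤
      RCLike.re ⟪ψ, (((WL2.linearEquiv ℂ ℂ (fun _ : TSite d m => c₁)).symm.toLinearMap ∘ₗ QprimeTowerW L m n φ U (c₀ := c₀)) ∘ₗ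
        GpOfUk L m n φ η U a' (c₁ := c₁) hpos' ∘ₗ GpOfUk L m n φ η U a' (c₁ := c₁) hpos' ∘ₗ
        LinearMap.adjoint ((WL2.linearEquiv ℂ ℂ (fun _ : TSite d m => c₁)).symm.toLinearMap ∘ₗ QprimeTowerW L m n φ U (c₀ := c₀))) ψ⟫_ℂ := by
  have hc₁ : 0 < c₁ := Fact.out
  have hL3' : 3 ≤ L ^ (n + 1) := le_trans hL3 (Nat.le_self_pow (Nat.succ_ne_zero n) L)
  have hN3 : (3 : ℝ) ≤ (L : ℝ) ^ (n + 1) := by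
    have h : ((3 : ℕ) : ℝ) ≤ ((L ^ (n + 1) : ℕ) : ℝ) := by exact_mod_cast hL3'
    simpa using h
  have hN0 : (0 : ℝ) < (L : ℝ) ^ (n + 1) := by linarith
  have hη0 : 0 < η := pos_of_mul_pos_left (by rw [hηL]; exact one_pos) hN0.le
  have hK0 : 0 ≤ 2 * Mφ * Mφ' := by positivity
  set ρ' : ℝ := (∏ j ∈ Finset.range (n + 1), (1 + 2 * Mφ * Mφ' * εU j) ^ (d * (L - 1))) - 1 with hρ'
  have hρ0 : 0 ≤ ρ' := rhoTower_nonneg n hK0 εU hεU (d * (L - 1))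
  have hρle : ρ' ≤ (4 / 27 : ℝ) ^ d / 2 := (rhoTower_le_exp_sub_one n hK0 hr0 hr1 hα0 εU hεU hεg (d * (L - 1))).trans hwin
  -- the window in the closed form of the prequel: `β∕B ≥ (4∕27)^d`
  have hwin' : ρ' * (((L : ℝ) ^ (n + 1)) ^ 2 / 4) ^ d ≤ (((L : ℝ) ^ (n + 1) - 1) * ((L : ℝ) ^ (n + 1) - 2) / 6) ^ d / 2 :=
    window_of_ratio hN3 hρle
  have key := qggq_coercive_window_tower L m n φ c₀ η c₁ hL3' ha' hMφ hMφ' hφ hφ' U hU (ε := α * η) (by positivity) hUε εU hεU hLε hLb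
    hRS hpos' hwin' ψ
  -- the diagonal readings `|η⁻¹| = L^{n+1}`, `c₀L^{(n+1)d}∕c₁ = 1`, `|η⁻¹|·Kαη = Kα`
  have hηinv : ‖((η : ℂ))⁻¹‖ = (L : ℝ) ^ (n + 1) := by
    rw [norm_inv, Complex.norm_real, Real.norm_eq_abs, abs_of_pos hη0,
      show η = ((L : ℝ) ^ (n + 1))⁻¹ by rw [← one_div]; field_simp; linarith [hηL], inv_inv]
  have hρw1 : c₀ * ((L : ℝ) ^ (n + 1)) ^ d / c₁ = 1 := by rw [hw, div_self hc₁.ne']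
  have he : ‖((η : ℂ))⁻¹‖ * (2 * Mφ * Mφ' * (α * η)) ≤ 2 * Mφ * Mφ' * α := by
    rw [hηinv, show (L : ℝ) ^ (n + 1) * (2 * Mφ * Mφ' * (α * η)) = 2 * Mφ * Mφ' * α * (η * (L : ℝ) ^ (n + 1)) by ring, hηL,
      mul_one]
  have hfloor := qggq_constant_scaled_ge (d := d) hN3 ha' hK0 hα0 hα1 (by positivity : 0 ≤ 2 * Mφ * Mφ' * (α * η)) hηinv hρw1
    he hρ0 hwin'
  exact le_trans (mul_le_mul_of_nonneg_right hfloor (sq_nonneg _)) key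

end Diagonal

/-! ## §3 KAPPA1, `k`-level half: `∃ κ > 0` before the block ratio, the profile rate and the height -/

section Exists

/-- `exp y − 1 ≤ 2y` on `0 ≤ y ≤ 1` (private arithmetic helper). [folklore] -/
private theorem exp_sub_one_le_two_mul {y : ℝ} (hy0 : 0 ≤ y) (hy1 : y ≤ 1) : Real.exp y - 1 ≤ 2 * y := by
  have h := Real.abs_exp_sub_one_sub_id_le (x := y) (by rw [abs_of_nonneg hy0]; exact hy1)
  have h' : Real.exp y - 1 - y ≤ y ^ 2 := (le_abs_self _).trans h
  nlinarith

variable {d : ℕ} {𝔸 : Type*} [NormedRing 𝔸] [NormedAlgebra ℂ 𝔸] [CompleteSpace 𝔸] [NormOneClass 𝔸]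
  {W : Type*} [NormedAddCommGroup W] [InnerProductSpace ℂ W] [FiniteDimensional ℂ W] (φ : W ≃ₗ[ℂ] 𝔸)
  {a' Mφ Mφ' : ℝ} (ha' : 0 < a') (hMφ : 0 ≤ Mφ) (hMφ' : 0 ≤ Mφ') (hφ : ∀ w, ‖φ w‖ ≤ Mφ * ‖w‖) (hφ' : ∀ X, ‖φ.symm X‖ ≤ Mφ' * ‖X‖)

include ha' hMφ hMφ' hφ hφ' in
/-- **KAPPA1, `k`-LEVEL HALF — THE THIRD OPERATOR OF THM 3.11 FOR PRINT's COMPOSITE AVERAGING, `∃ κ > 0` BEFORE THE BLOCK RATIO, THE PROFILE RATE,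
THE HEIGHT, THE LATTICE AND THE BACKGROUND**: there is `κ > 0` (the closed form `κ₀(d, a′, 2M_φM_φ′)` of `qggq_coercive_tower_diagonal_geometric`) such
that for every block ratio `L ≥ 3` and profile rate `r ∈ [0,1[` there is `α₁ > 0` (closed form in `(d, K, L, r)`: `min 1 ((4∕27)^d∕(4(c+1)))`,
`c = d(L−1)K∕(1−r)`) with: for every height `n`, `η` on the diagonal `ηL^{n+1} = 1`, weights `c₀(L^{n+1})^d = c₁`, period `m`, background `U`
(mutually adjoint transporters, `‖U(b) − 1‖ ≤ αη`, `‖Ū^j(b) − 1‖ ≤ ε_j ≤ αr^j`, all in `U1`), every `0 ≤ α ≤ α₁`, every positivity witness `hpos′` of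
`Δ′_{a′,k}(U)` and every coarse `ψ`: `κ·‖ψ‖² ≤ re⟪ψ, Q̃′_kG′_k(U)²Q̃′_k(U)†ψ⟫`.  (`hpos′` itself is inhabited in a smaller level-free window by
`B9Thm311SitePrimeFormCoerciveTowerCanonical.laplacePrimeAk_pos_diagonal_geometric`.)
[cite: Balaban1985BackgroundPropagators, Thm 3.11 p.416, (3.19) p.393, (3.24)–(3.25) p.394, (3.35)–(3.37) p.396; Balaban1984PropagatorsI, (1.18) p.20; Balaban1984PropagatorsII, (2.74)–(2.77) p.236] -/
theorem exists_qggq_coercive_tower_diagonal :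
    ∃ κ : ℝ, 0 < κ ∧ ∀ (L : ℕ) [NeZero L], 3 ≤ L → ∀ (r : ℝ), 0 ≤ r → r < 1 →
      ∃ α₁ : ℝ, 0 < α₁ ∧ ∀ (n : ℕ) (η : ℝ), η * (L : ℝ) ^ (n + 1) = 1 →
      ∀ (c₀ c₁ : ℝ) [Fact (0 < c₀)] [Fact (0 < c₁)], c₀ * ((L : ℝ) ^ (n + 1)) ^ d = c₁ →
      ∀ (m : Fin d → ℕ) [∀ i, NeZero (m i)] (U : Bond d (towerP L m (n + 1)) → 𝔸ˣ),
        (∀ (b : Bond d (towerP L m (n + 1))) (v u : W), ⟪adTransportW φ U b v, u⟫_ℂ = ⟪v, adTransportW φ (fun b => (U b)⁻¹) b u⟫_ℂ) →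
      ∀ (α : ℝ), 0 ≤ α → α ≤ α₁ → (∀ b, U b ∈ U1 𝔸) → (∀ b, ‖(U b : 𝔸) - 1‖ ≤ α * η) →
      ∀ (εU : ℕ → ℝ), (∀ j, 0 ≤ εU j) → (∀ j < n + 1, εU j ≤ α * r ^ j) →
        (∀ (j : ℕ) (b : Bond d (towerP L m (j + 1))), ‖(UlevOf L m (n + 1) U j b : 𝔸) - 1‖ ≤ εU j) →
        (∀ (j : ℕ) (b : Bond d (towerP L m (j + 1))), UlevOf L m (n + 1) U j b ∈ U1 𝔸) →
      ∀ (hpos' : ∀ x : SiteL2K ℂ d (towerP L m (n + 1)) c₀ W, x ≠ 0 → 0 < RCLike.re ⟪x, laplacePrimeAk L m n φ η U a' (c₁ := c₁) x⟫_ℂ)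
        (ψ : SiteL2K ℂ d m c₁ W),
        κ * ‖ψ‖ ^ 2 ≤
          RCLike.re ⟪ψ, (((WL2.linearEquiv ℂ ℂ (fun _ : TSite d m => c₁)).symm.toLinearMap ∘ₗ QprimeTowerW L m n φ U (c₀ := c₀)) ∘ₗ
            GpOfUk L m n φ η U a' (c₁ := c₁) hpos' ∘ₗ GpOfUk L m n φ η U a' (c₁ := c₁) hpos' ∘ₗ
            LinearMap.adjoint ((WL2.linearEquiv ℂ ℂ (fun _ : TSite d m => c₁)).symm.toLinearMap ∘ₗ QprimeTowerW L m n φ U (c₀ := c₀))) ψ⟫_ℂ := by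
  refine ⟨1 / (36 * ((32 * (d : ℝ) + 2 * (d : ℝ) * (2 * Mφ * Mφ') ^ 2) * (729 / 16) ^ d + 9 * a' / 4) ^ 2), by positivity, ?_⟩
  intro L _ hL3 r hr0 hr1
  have h1r : 0 < 1 - r := by linarith
  obtain ⟨c, hc0, hcdef⟩ : ∃ c : ℝ, 0 ≤ c ∧ c = ((d * (L - 1) : ℕ) : ℝ) * (2 * Mφ * Mφ') / (1 - r) := ⟨_, by positivity, rfl⟩
  have hX1 : (4 / 27 : ℝ) ^ d ≤ 1 := pow_le_one₀ (by norm_num) (by norm_num)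
  refine ⟨min 1 ((4 / 27 : ℝ) ^ d / (4 * (c + 1))), lt_min one_pos (by positivity), ?_⟩
  intro n η hηL c₀ c₁ _ _ hw m _ U hRS α hα0 hαle hUb hUε εU hεU hεg hLε hLb hpos' ψ
  have hα1 : α ≤ 1 := hαle.trans (min_le_left _ _)
  have hαc : α * (4 * (c + 1)) ≤ (4 / 27 : ℝ) ^ d := (le_div_iff₀ (by positivity)).1 (hαle.trans (min_le_right _ _))
  have hy0 : 0 ≤ c * α := mul_nonneg hc0 hα0
  have hcα : c * α ≤ (c + 1) * α := mul_le_mul_of_nonneg_right (by linarith) hα0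
  have hy1 : c * α ≤ 1 := by linarith [hcα, hαc, hX1]
  have hwin : Real.exp (((d * (L - 1) : ℕ) : ℝ) * (2 * Mφ * Mφ' * α / (1 - r))) - 1 ≤ (4 / 27 : ℝ) ^ d / 2 := by
    rw [show ((d * (L - 1) : ℕ) : ℝ) * (2 * Mφ * Mφ' * α / (1 - r)) = c * α by rw [hcdef]; field_simp]
    calc Real.exp (c * α) - 1 ≤ 2 * (c * α) := exp_sub_one_le_two_mul hy0 hy1
      _ ≤ (4 / 27 : ℝ) ^ d / 2 := by linarith [hcα, hαc]
  exact qggq_coercive_tower_diagonal_geometric L m n φ c₀ η c₁ hL3 ha' hMφ hMφ' hφ hφ' U hUb hα0 hα1 hUε εU hεU hLε hLb hRS hpos' hηL hw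
    hr0 hr1 hεg hwin ψ


include ha' hMφ hMφ' hφ hφ' in
/-- **… WITH THE POSITIVITY LETTER DISCHARGED TOO** — `∃ κ > 0, ∀ L ≥ 3, ∀ r ∈ [0,1[, ∃ α₁ > 0, ∀ n η c₀ c₁ m U α (ε_j)` of the diagonal window:
`Δ′_{a′,k}(U)` IS positive definite (so `G′_k(U)` and the third operator EXIST — this lineage's g64
`B9Thm311SitePrimeFormCoerciveTowerCanonical.exists_strong_site_coercive_tower_diagonal` read through the owner's `laplacePrimeAk_pos_of_coercive'`) AND for
every positivity witness and every coarse `ψ`: `κ‖ψ‖² ≤ re⟪ψ, Q̃′_kG′_k(U)²Q̃′_k(U)†ψ⟫` — no displayed letter left but print's running axioms ((3.35)–(3.37):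
the edge, the profile, `U, Ū^j ∈ U1`, mutually adjoint transporters).
[cite: Balaban1985BackgroundPropagators, Thm 3.11 p.416, (3.24)–(3.25) p.394, (3.35)–(3.37) p.396; Balaban1984PropagatorsI, (1.18) p.20] -/
theorem exists_qggq_coercive_tower_diagonal_closed :
    ∃ κ : ℝ, 0 < κ ∧ ∀ (L : ℕ) [NeZero L], 3 ≤ L → ∀ (r : ℝ), 0 ≤ r → r < 1 →
      ∃ α₁ : ℝ, 0 < α₁ ∧ ∀ (n : ℕ) (η : ℝ), η * (L : ℝ) ^ (n + 1) = 1 →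
      ∀ (c₀ c₁ : ℝ) [Fact (0 < c₀)] [Fact (0 < c₁)], c₀ * ((L : ℝ) ^ (n + 1)) ^ d = c₁ →
      ∀ (m : Fin d → ℕ) [∀ i, NeZero (m i)] (U : Bond d (towerP L m (n + 1)) → 𝔸ˣ),
        (∀ (b : Bond d (towerP L m (n + 1))) (v u : W), ⟪adTransportW φ U b v, u⟫_ℂ = ⟪v, adTransportW φ (fun b => (U b)⁻¹) b u⟫_ℂ) →
      ∀ (α : ℝ), 0 ≤ α → α ≤ α₁ → (∀ b, U b ∈ U1 𝔸) → (∀ b, ‖(U b : 𝔸) - 1‖ ≤ α * η) →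
      ∀ (εU : ℕ → ℝ), (∀ j, 0 ≤ εU j) → (∀ j < n + 1, εU j ≤ α * r ^ j) →
        (∀ (j : ℕ) (b : Bond d (towerP L m (j + 1))), ‖(UlevOf L m (n + 1) U j b : 𝔸) - 1‖ ≤ εU j) →
        (∀ (j : ℕ) (b : Bond d (towerP L m (j + 1))), UlevOf L m (n + 1) U j b ∈ U1 𝔸) →
      (∀ x : SiteL2K ℂ d (towerP L m (n + 1)) c₀ W, x ≠ 0 → 0 < RCLike.re ⟪x, laplacePrimeAk L m n φ η U a' (c₁ := c₁) x⟫_ℂ) ∧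
      ∀ (hpos' : ∀ x : SiteL2K ℂ d (towerP L m (n + 1)) c₀ W, x ≠ 0 → 0 < RCLike.re ⟪x, laplacePrimeAk L m n φ η U a' (c₁ := c₁) x⟫_ℂ)
        (ψ : SiteL2K ℂ d m c₁ W),
        κ * ‖ψ‖ ^ 2 ≤
          RCLike.re ⟪ψ, (((WL2.linearEquiv ℂ ℂ (fun _ : TSite d m => c₁)).symm.toLinearMap ∘ₗ QprimeTowerW L m n φ U (c₀ := c₀)) ∘ₗ
            GpOfUk L m n φ η U a' (c₁ := c₁) hpos' ∘ₗ GpOfUk L m n φ η U a' (c₁ := c₁) hpos' ∘ₗ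
            LinearMap.adjoint ((WL2.linearEquiv ℂ ℂ (fun _ : TSite d m => c₁)).symm.toLinearMap ∘ₗ QprimeTowerW L m n φ U (c₀ := c₀))) ψ⟫_ℂ := by
  obtain ⟨κ, hκ, H⟩ := exists_qggq_coercive_tower_diagonal (d := d) φ ha' hMφ hMφ' hφ hφ'
  refine ⟨κ, hκ, ?_⟩
  intro L _ hL3 r hr0 hr1
  obtain ⟨α₁, hα₁, H1⟩ := H L hL3 r hr0 hr1
  obtain ⟨α₀, γ', hα₀, hγ', HC⟩ := exists_strong_site_coercive_tower_diagonal (d := d) L φ hMφ hMφ' hφ hφ' ha' hr0 hr1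
  refine ⟨min α₀ α₁, lt_min hα₀ hα₁, ?_⟩
  intro n η hηL c₀ c₁ _ _ hw m _ U hRS α hα0 hαle hUb hUε εU hεU hεg hLε hLb
  have hcoer := HC n η hηL c₀ c₁ hw m U hRS α hα0 (hαle.trans (min_le_left _ _)) hUb hUε εU hεU hεg hLε hLb
  refine ⟨laplacePrimeAk_pos_of_coercive' L m n φ η U a' hγ' (fun x => ?_), fun hpos' ψ =>
    H1 n η hηL c₀ c₁ hw m U hRS α hα0 (hαle.trans (min_le_right _ _)) hUb hUε εU hεU hεg hLε hLb hpos' ψ⟩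
  have h := hcoer x
  nlinarith [h, mul_nonneg hγ'.le (sq_nonneg ‖covDerivL2K ℂ c₀ ((η : ℂ))⁻¹
    (adTransportW φ (fun _ : Bond d (towerP L m (n + 1)) => (1 : 𝔸ˣ))) x‖)]

end Exists


/-! ## §4 Junction at height zero: the tower third operator at `n = 0` IS the one-shot third operator -/

section Junction

variable {d : ℕ} (L : ℕ) [NeZero L] (m : Fin d → ℕ) [∀ i, NeZero (m i)]
  {𝔸 : Type*} [NormedRing 𝔸] [NormedAlgebra ℂ 𝔸] [CompleteSpace 𝔸] [NormOneClass 𝔸]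
  {W : Type*} [NormedAddCommGroup W] [InnerProductSpace ℂ W] [FiniteDimensional ℂ W] (φ : W ≃ₗ[ℂ] 𝔸)
  (c₀ : ℝ) [Fact (0 < c₀)] (η : ℝ) (c₁ : ℝ) [Fact (0 < c₁)] (a' : ℝ) (U : Bond d (towerP L m 1) → 𝔸ˣ)

omit [NormOneClass 𝔸] in
/-- At height one the only level background is `U` itself: `Ū^{0} = U` (`avgIter 0`, `perSite ∘ liftSite = id`). [cite: Balaban1985BackgroundPropagators, (3.15)∕(3.19) p.393] -/
theorem UlevOf_one_zero : UlevOf L m 1 U 0 = U := by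
  funext b
  simp [UlevOf, B7Prop2Explicit.avgIter_zero, perCfg, perSite_liftSite]

omit [NormOneClass 𝔸] [FiniteDimensional ℂ W] [Fact (0 < c₀)] in
/-- **`Q′_1(U) = Q′(U)`**: the composite averaging with ONE factor is the one-step averaging (`towerP L m 1 = fineP L m` by `rfl`).
[cite: Balaban1985BackgroundPropagators, (3.19) p.393] -/
theorem QprimeTowerW_zero : QprimeTowerW L m 0 φ U (c₀ := c₀) = QprimeW L m φ U (c₀ := c₀) := by
  rw [QprimeTowerW, QprimeTower_succ, QprimeTower_zero, UlevOf_one_zero]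
  rfl

omit [NormOneClass 𝔸] in
/-- **`Δ′_{a′,1}(U) = Δ′_{a′}(U)`** — the `k`-level site operator (3.24) at one level IS the one-step one. [cite: Balaban1985BackgroundPropagators, (3.24) p.394] -/
theorem laplacePrimeAk_zero :
    laplacePrimeAk L m 0 φ η U a' (c₀ := c₀) (c₁ := c₁) = laplacePrimeA L m φ η U a' (c₀ := c₀) (c₁ := c₁) := by
  rw [laplacePrimeAk, laplacePrimeA, QprimeTowerW_zero]
  rfl

omit [NormOneClass 𝔸] in
/-- **`G′_1(U) = G′(U)`** for any two positivity witnesses. [cite: Balaban1985BackgroundPropagators, (3.25) p.394] -/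
theorem GpOfUk_zero
    (hposk : ∀ x : SiteL2K ℂ d (towerP L m 1) c₀ W, x ≠ 0 → 0 < RCLike.re ⟪x, laplacePrimeAk L m 0 φ η U a' (c₁ := c₁) x⟫_ℂ)
    (hpos1 : ∀ x : SiteL2K ℂ d (fineP L m) c₀ W, x ≠ 0 → 0 < RCLike.re ⟪x, laplacePrimeA L m φ η U a' (c₁ := c₁) x⟫_ℂ) :
    GpOfUk L m 0 φ η U a' (c₁ := c₁) hposk = GpOfU L m φ η U a' (c₁ := c₁) hpos1 := by
  have h := laplacePrimeAk_zero L m φ c₀ η c₁ a' U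
  unfold GpOfUk GpOfU
  congr 1

omit [NormOneClass 𝔸] in
/-- **JUNCTION: AT HEIGHT `n = 0` THE `k`-LEVEL THIRD OPERATOR IS THE ONE-SHOT THIRD OPERATOR** (`B9Eq325ProjFormulaTower.QGGQk_pos`'s operator at
`n = 0` = `B9Eq325ProjFormula.QGGQ_pos`'s operator, LITERALLY, for any two positivity witnesses) — so every bound of this file ∕ the prequel at
`n = 0` is a bound for ne9-leaf-01's one-shot operator, and conversely `B9Eq365QGGQLowerVariationalWindowUniform` is the `n = 0` floor with the
`L`-free edge `ε₀ = αη`. [cite: Balaban1985BackgroundPropagators, (3.25) p.394, (3.19) p.393] -/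
theorem QGGQk_zero
    (hposk : ∀ x : SiteL2K ℂ d (towerP L m 1) c₀ W, x ≠ 0 → 0 < RCLike.re ⟪x, laplacePrimeAk L m 0 φ η U a' (c₁ := c₁) x⟫_ℂ)
    (hpos1 : ∀ x : SiteL2K ℂ d (fineP L m) c₀ W, x ≠ 0 → 0 < RCLike.re ⟪x, laplacePrimeA L m φ η U a' (c₁ := c₁) x⟫_ℂ) :
    ((WL2.linearEquiv ℂ ℂ (fun _ : TSite d m => c₁)).symm.toLinearMap ∘ₗ QprimeTowerW L m 0 φ U (c₀ := c₀)) ∘ₗ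
        GpOfUk L m 0 φ η U a' (c₁ := c₁) hposk ∘ₗ GpOfUk L m 0 φ η U a' (c₁ := c₁) hposk ∘ₗ
        LinearMap.adjoint ((WL2.linearEquiv ℂ ℂ (fun _ : TSite d m => c₁)).symm.toLinearMap ∘ₗ QprimeTowerW L m 0 φ U (c₀ := c₀)) =
      ((WL2.linearEquiv ℂ ℂ (fun _ : TSite d m => c₁)).symm.toLinearMap ∘ₗ QprimeW L m φ U (c₀ := c₀)) ∘ₗ
        GpOfU L m φ η U a' (c₁ := c₁) hpos1 ∘ₗ GpOfU L m φ η U a' (c₁ := c₁) hpos1 ∘ₗ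
        LinearMap.adjoint ((WL2.linearEquiv ℂ ℂ (fun _ : TSite d m => c₁)).symm.toLinearMap ∘ₗ QprimeW L m φ U (c₀ := c₀)) := by
  rw [GpOfUk_zero L m φ c₀ η c₁ a' U hposk hpos1, QprimeTowerW_zero]
  rfl

end Junction

end Literature.MathematicalPhysics.QuantumFieldTheory.Balaban1983to89.B9Eq365QGGQLowerVariationalWindowTowerDiagonal

end
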